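import Mathlib
import Literature.Combinatorics.Optimization.FractionalLpFormulations
import HarnessLib

/-!
# LP rank and SDP rank: the exact factorization theorems (Braun–Pokutta–Roy 2016, Def. 2.18, Rem. 2.19, Thm. 2.26, Thm. 4.4)

G. Braun, S. Pokutta, A. Roy, *Strong reductions for extended formulations* [BraunPokuttaRoy2016] (arXiv:1512.04932v3
numbering), §2.2.3: **Def. 2.18** "We define variants ignoring factors of the form `a𝟙`: an *LP factorization* of `M` of
size `r` is a decomposition `M = Σ_{i=1}^r M_i + u𝟙` … as a sum of `r` nonnegative matrices `M_i` of rank `1` and possibly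
an additional nonnegative rank-`1` `u𝟙` with all columns being equal.  The *LP rank* `rk_LP M` is the minimum `r` …
An *SDP factorization* of `M` of size `r` is a decomposition `M(𝔍,s) = Tr[A_𝔍 B_s] + u_𝔍` where the `A_𝔍` and `B_s` are
psd `r × r` matrices, and `u_𝔍` is a nonnegative number.  The *SDP rank* `rk_SDP M` is the minimum `r` …";
**Remark 2.19** "This causes a difference of at most `1` between the two ranks.  The motivation for the LP rank is that
it captures exactly the LP formulation complexity"; **Thm. 2.26** (factorization theorem [BPZ2015]):
`fc(𝒫, C, S) = rk_LP M_{𝒫,C,S}`, `fc_SDP(𝒫, C, S) = rk_SDP M_{𝒫,C,S}`; **Thm. 4.4**: the same for fractional problems.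
(= G. Braun, S. Pokutta, D. Zink [BraunPokuttaZink2015], Thm. 3.5.)

The earlier files of this story state the factorization theorems in `nnr`/`rk_psd` currency with the resulting `±1`
(`LpFormulationReductions.lean`, `SdpFormulationReductions.lean`, `FractionalLpFormulations.lean`).  This file adds the
paper's own EXACT currency — all PROVED, no named facts:

* `HasLPFactorization M r`, `HasSDPFactorization M r` — Def. 2.18 verbatim.
* Remark 2.19: `HasNonnegFactorization.hasLPFactorization` (`rk_LP ≤ rk_+`), `HasLPFactorization.hasNonnegFactorization`
  (`rk_+ ≤ rk_LP + 1`), `HasPsdFactorization.hasSDPFactorization`, `HasSDPFactorization.hasPsdFactorization`.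
* **Thm. 2.26 exactly**: `LPFormulation.hasLPFactorization_slackMatrix` (size `R` ⇒ size `R`, affine Farkas
  `Literature.Analysis.Convex.LPDuality.affine_farkas`: `C(𝔍) − w_𝔍(x) = u_𝔍·(b − Ax) + γ_𝔍`),
  `LPFormulation.ofLPFactorization` (size `r` ⇒ size `r`: LP `x ≥ 0`, `w_𝔍 = C(𝔍) − u_𝔍x − γ_𝔍`),
  `LPFormulation.nonempty_iff_hasLPFactorization`; `SDPFormulation.hasSDPFactorization_slackMatrix` (size `d` ⇒ size `d`,
  the conic-duality step being the TREE THEOREM `SDPFormulation.exists_posSemidef_slack` [BraunEtAl2016, Lemma 2.3]),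
  `SDPFormulation.ofSDPFactorization`, `SDPFormulation.nonempty_iff_hasSDPFactorization`.
* **Thm. 4.4 (LP) exactly** for fractional problems: `FracLPFormulation.hasLPFactorization_slackMatrix`,
  `FracLPFormulation.ofLPFactorization`, `FracLPFormulation.nonempty_iff_hasLPFactorization`.
* [BraunPokuttaZink2015, Remark 3.6] ("every row contains a `0` entry, hence the `μ𝟙` term must be `0` … the
  nonnegative rank and LP rank coincide for polytopes"): `HasLPFactorization.hasNonnegFactorization_of_rowZero`,
  `HasSDPFactorization.hasPsdFactorization_of_rowZero`, and for problems whose completeness guarantee is attained on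
  every sound instance `LPFormulation.nonempty_iff_hasNonnegFactorization_of_attained` /
  `SDPFormulation.nonempty_iff_hasPsdFactorization_of_attained` (`fc = rk_+`, `fc_SDP = rk_psd` on the nose).

Not here: Thm. 4.4's SDP clause in the direction "formulation ⇒ SDP factorization" (conic duality for pairs of affine
functions), and the general nonnegativity problems of Def. 2.16 (of which `𝒫_{C,S}` is the instance used throughout).
-/

noncomputable section

open Finset Matrix
open scoped MatrixOrder

namespace Literature.Combinatorics.Optimization

open Literature.Analysis.Convex (LPDuality.affine_farkas)

variable {σ φ : Type*}

/-! ### Def. 2.18: LP factorizations and SDP factorizations ("variants ignoring factors of the form `a𝟙`") -/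

/-- **Def. 2.18 (LP factorization of size `r`)**: `M = Σ_{i=1}^r M_i + u𝟙` with `M_i` nonnegative of rank one and
`u𝟙` "an additional nonnegative rank-1 with all columns being equal": `M(i,j) = Σ_l U(i,l) V(l,j) + u(i)`,
`U, V, u ≥ 0`.  `rk_LP M` is the least such `r`. [cite: BraunPokuttaRoy2016, Def. 2.18 (arXiv v3)] -/
def HasLPFactorization {ι κ : Type*} (M : ι → κ → ℝ) (r : ℕ) : Prop :=
  ∃ (U : ι → Fin r → ℝ) (V : Fin r → κ → ℝ) (u : ι → ℝ), (∀ i l, 0 ≤ U i l) ∧ (∀ l j, 0 ≤ V l j) ∧ (∀ i, 0 ≤ u i) ∧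
    ∀ i j, M i j = ∑ l, U i l * V l j + u i

/-- **Def. 2.18 (SDP factorization of size `r`)**: `M(i,j) = Tr[A_i B_j] + u_i` with `A_i, B_j ∈ 𝕊^r_+` and `u_i ≥ 0`.
`rk_SDP M` is the least such `r`. [cite: BraunPokuttaRoy2016, Def. 2.18 (arXiv v3)] -/
def HasSDPFactorization {ι κ : Type*} (M : ι → κ → ℝ) (r : ℕ) : Prop :=
  ∃ (A : ι → Matrix (Fin r) (Fin r) ℝ) (B : κ → Matrix (Fin r) (Fin r) ℝ) (u : ι → ℝ),
    (∀ i, (A i).PosSemidef) ∧ (∀ j, (B j).PosSemidef) ∧ (∀ i, 0 ≤ u i) ∧ ∀ i j, M i j = (A i * B j).trace + u i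

/-! ### Remark 2.19: "a difference of at most 1 between the two ranks" -/

/-- `rk_LP ≤ rk_+` (take `u = 0`). [cite: BraunPokuttaRoy2016, Rem. 2.19 (arXiv v3)] -/
theorem HasNonnegFactorization.hasLPFactorization {ι κ : Type*} {M : ι → κ → ℝ} {r : ℕ}
    (h : HasNonnegFactorization M r) : HasLPFactorization M r := by
  obtain ⟨U, V, hU, hV, hM⟩ := h
  exact ⟨U, V, fun _ => 0, hU, hV, fun _ => le_rfl, fun i j => by rw [hM i j, add_zero]⟩

/-- `rk_+ ≤ rk_LP + 1` (the term `u𝟙` is one more nonnegative rank-one summand).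
[cite: BraunPokuttaRoy2016, Rem. 2.19 (arXiv v3)] -/
theorem HasLPFactorization.hasNonnegFactorization {ι κ : Type*} {M : ι → κ → ℝ} {r : ℕ}
    (h : HasLPFactorization M r) : HasNonnegFactorization M (r + 1) := by
  obtain ⟨U, V, u, hU, hV, hu, hM⟩ := h
  have h1 : HasNonnegFactorization (fun i j => ∑ l, U i l * V l j) r := ⟨U, V, hU, hV, fun _ _ => rfl⟩
  have h2 : HasNonnegFactorization (fun (i : ι) (_ : κ) => u i) 1 :=
    hasNonnegFactorization_of_rowConst u (fun _ _ => rfl) (fun i _ => hu i)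
  have h12 := h1.add h2
  obtain ⟨U', V', hU', hV', hM'⟩ := h12
  exact ⟨U', V', hU', hV', fun i j => by rw [hM i j]; exact hM' i j⟩

/-- `rk_SDP ≤ rk_psd` (take `u = 0`). [cite: BraunPokuttaRoy2016, Rem. 2.19 (arXiv v3)] -/
theorem HasPsdFactorization.hasSDPFactorization {ι κ : Type*} {M : ι → κ → ℝ} {r : ℕ}
    (h : HasPsdFactorization M r) : HasSDPFactorization M r := by
  obtain ⟨A, B, hA, hB, hM⟩ := h
  exact ⟨A, B, fun _ => 0, hA, hB, fun _ => le_rfl, fun i j => by rw [hM i j, add_zero]⟩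

/-- `rk_psd ≤ rk_SDP + 1`. [cite: BraunPokuttaRoy2016, Rem. 2.19 (arXiv v3)] -/
theorem HasSDPFactorization.hasPsdFactorization {ι κ : Type*} {M : ι → κ → ℝ} {r : ℕ}
    (h : HasSDPFactorization M r) : HasPsdFactorization M (r + 1) := by
  obtain ⟨A, B, u, hA, hB, hu, hM⟩ := h
  have h1 : HasPsdFactorization (fun i j => (A i * B j).trace) r := ⟨A, B, hA, hB, fun _ _ => rfl⟩
  have h2 : HasPsdFactorization (fun (i : ι) (_ : κ) => u i) 1 :=
    MaxProblem.Reduction.hasPsdFactorization_of_rowConst u (fun _ _ => rfl) (fun i _ => hu i)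
  have h12 := h1.add h2
  obtain ⟨A', B', hA', hB', hM'⟩ := h12
  refine ⟨A', B', hA', hB', fun i j => by rw [hM i j]; simpa using hM' i j⟩

/-! ### Thm. 2.26 (= BPZ15 Thm. 3.5), exactly: `fc(𝒫,C,S) = rk_LP M_{𝒫,C,S}` -/

variable {R : ℕ}

/-- **Thm. 2.26 / Thm. 2.20, LP, "formulation ⇒ LP factorization of the SAME size":** "By Farkas's lemma there are
nonnegative `u_𝔍` and nonnegative numbers `γ_𝔍` with `w_𝔍(x) = u_𝔍·(b − Ax) + γ_𝔍`.  Substituting `x` by `x^s`, we obtain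
an LP factorization of size `fc(𝒫)`" (for `𝒫_{C,S}`: `C(𝔍) − w_𝔍(x) = u_𝔍·(b − Ax) + γ_𝔍`).
[cite: BraunPokuttaRoy2016, Thm. 2.26 via proof of Thm. 2.20 (arXiv v3)] [cite: BraunPokuttaZink2015, Thm. 3.5] -/
theorem LPFormulation.hasLPFactorization_slackMatrix {P : MaxProblem σ φ} (E : LPFormulation P R) :
    HasLPFactorization P.slackMatrix R := by
  classical
  rcases isEmpty_or_nonempty σ with hσ | ⟨⟨s₀⟩⟩
  · exact ⟨fun _ _ => 0, fun _ s => isEmptyElim s, fun _ => 0, fun _ _ => le_rfl, fun _ s => isEmptyElim s,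
      fun _ => le_rfl, fun _ s => isEmptyElim s⟩
  have hP : ∃ y : Fin E.D → ℝ, E.A *ᵥ y ≤ E.b := ⟨E.x s₀, fun i => E.mem s₀ i⟩
  have hfar : ∀ f : {f : φ // P.Sound f}, ∃ u : Fin R → ℝ, 0 ≤ u ∧ u ᵥ* E.A = E.w f.1 ∧
      u ⬝ᵥ E.b ≤ P.C f.1 - E.c f.1 := fun f =>
    LPDuality.affine_farkas E.A E.b (E.w f.1) hP fun y hy => by
      have := E.achieves f.1 f.2 y (fun i => hy i); linarith
  choose u hu huA hub using hfar
  refine ⟨u, fun i s => E.b i - (E.A *ᵥ E.x s) i, fun f => P.C f.1 - E.c f.1 - u f ⬝ᵥ E.b, fun f l => hu f l,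
    fun i s => by linarith [E.mem s i], fun f => by linarith [hub f], fun f s => ?_⟩
  simp only [MaxProblem.slackMatrix_apply]
  have hws : E.w f.1 ⬝ᵥ E.x s = u f ⬝ᵥ (E.A *ᵥ E.x s) := by rw [← huA f, Matrix.dotProduct_mulVec]
  have hex := E.exact f.1 f.2 s
  have hsum : ∑ i : Fin R, u f i * (E.b i - (E.A *ᵥ E.x s) i) = u f ⬝ᵥ E.b - u f ⬝ᵥ (E.A *ᵥ E.x s) := by
    simp only [dotProduct, mul_sub, sum_sub_distrib]
  rw [hsum]
  linarith

/-- **Thm. 2.26 / Thm. 2.20, LP, "LP factorization ⇒ formulation of the SAME size":** "The linear program is `x ≥ 0` …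
`s` is represented by `x^s` … `w_𝔍(x) := u_𝔍 x + γ_𝔍`" (for `𝒫_{C,S}`: `w_𝔍(x) = C(𝔍) − u_𝔍 x − γ_𝔍`).
[cite: BraunPokuttaRoy2016, Thm. 2.26 via proof of Thm. 2.20 (arXiv v3)] [cite: BraunPokuttaZink2015, Thm. 3.5] -/
def LPFormulation.ofLPFactorization (P : MaxProblem σ φ) {r : ℕ} (U : {f : φ // P.Sound f} → Fin r → ℝ)
    (V : Fin r → σ → ℝ) (u : {f : φ // P.Sound f} → ℝ) (hU : ∀ f l, 0 ≤ U f l) (hV : ∀ l s, 0 ≤ V l s)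
    (hu : ∀ f, 0 ≤ u f) (hM : ∀ f s, P.slackMatrix f s = ∑ l, U f l * V l s + u f) : LPFormulation P r := by
  classical
  exact
  { D := r
    A := -1
    b := 0
    x := fun s l => V l s
    mem := fun s i => by simp [Matrix.neg_mulVec, hV i s]
    w := fun f => if h : P.Sound f then -U ⟨f, h⟩ else 0
    c := fun f => if h : P.Sound f then P.C f - u ⟨f, h⟩ else 0
    exact := fun f hf s => by
      have h := hM ⟨f, hf⟩ s
      simp only [MaxProblem.slackMatrix_apply] at h
      simp only [dif_pos hf, dotProduct, Pi.neg_apply, neg_mul, Finset.sum_neg_distrib]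
      linarith
    achieves := fun f hf y hy => by
      simp only [dif_pos hf, dotProduct, Pi.neg_apply, neg_mul, Finset.sum_neg_distrib]
      have hy' : ∀ l, 0 ≤ y l := fun l => by
        have := hy l; simpa [Matrix.neg_mulVec] using this
      have : 0 ≤ ∑ l, U ⟨f, hf⟩ l * y l := sum_nonneg fun l _ => mul_nonneg (hU _ _) (hy' l)
      linarith [hu ⟨f, hf⟩] }

/-- **Thm. 2.26, LP clause, exactly** (`fc(𝒫, C, S) = rk_LP M_{𝒫,C,S}`): an LP formulation of size `R` exists iff the slack
matrix has an LP factorization of size `R`. [cite: BraunPokuttaRoy2016, Thm. 2.26 (arXiv v3)] [cite: BraunPokuttaZink2015, Thm. 3.5] -/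
theorem LPFormulation.nonempty_iff_hasLPFactorization (P : MaxProblem σ φ) :
    Nonempty (LPFormulation P R) ↔ HasLPFactorization P.slackMatrix R := by
  constructor
  · rintro ⟨E⟩; exact E.hasLPFactorization_slackMatrix
  · rintro ⟨U, V, u, hU, hV, hu, hM⟩; exact ⟨LPFormulation.ofLPFactorization P U V u hU hV hu hM⟩

/-! ### Thm. 2.26, SDP clause, exactly: `fc_SDP(𝒫,C,S) = rk_SDP M_{𝒫,C,S}` -/

variable {d : ℕ}

/-- **Thm. 2.26 / Thm. 2.20, SDP, "formulation ⇒ SDP factorization of the SAME size":** by conic duality there are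
`U^𝔍 ⪰ 0` and `μ_𝔍 ≥ 0` with `C(𝔍) − val_𝔍(s) = Tr[U^𝔍 X^s] + μ_𝔍` — the tree theorem
`SDPFormulation.exists_posSemidef_slack` [BraunEtAl2016, Lemma 2.3].
[cite: BraunPokuttaRoy2016, Thm. 2.26 via Thm. 2.20 (arXiv v3)] [cite: BraunPokuttaZink2015, Thm. 3.5] -/
theorem SDPFormulation.hasSDPFactorization_slackMatrix {P : MaxProblem σ φ} (E : SDPFormulation P d) :
    HasSDPFactorization P.slackMatrix d := by
  classical
  choose U hU μ hμ hslack using fun f : {f : φ // P.Sound f} => E.exists_posSemidef_slack f.2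
  exact ⟨U, E.X, μ, hU, E.posSemidef_X, hμ, fun f s => by rw [MaxProblem.slackMatrix_apply]; exact hslack f s⟩

/-- `Y ↦ Tr[G Y]` as a linear functional. [folklore] -/
private def trLin {r : ℕ} (G : Matrix (Fin r) (Fin r) ℝ) : Matrix (Fin r) (Fin r) ℝ →ₗ[ℝ] ℝ where
  toFun Y := (G * Y).trace
  map_add' Y Z := by simp only [Matrix.mul_add, trace_add]
  map_smul' a Y := by simp only [Matrix.mul_smul, trace_smul, smul_eq_mul, RingHom.id_apply]

/-- Unfolding `trLin`. [folklore] -/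
@[simp] private theorem trLin_apply {r : ℕ} (G Y : Matrix (Fin r) (Fin r) ℝ) : trLin G Y = (G * Y).trace := rfl

/-- `Tr[A B] ≥ 0` for real psd `A, B`. [folklore] -/
private theorem trace_mul_nonneg {r : ℕ} {A B : Matrix (Fin r) (Fin r) ℝ} (hA : A.PosSemidef) (hB : B.PosSemidef) :
    0 ≤ (A * B).trace := by
  set S : Matrix (Fin r) (Fin r) ℝ := CFC.sqrt A with hS
  have hSpsd : S.PosSemidef := (CFC.sqrt_nonneg A).posSemidef
  have hSS : S * S = A := CFC.sqrt_mul_sqrt_self A hA.nonneg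
  have hSH : Sᴴ = S := hSpsd.1
  have hM : (S * B * Sᴴ).PosSemidef := hB.mul_mul_conjTranspose_same S
  have htrM : (S * B * Sᴴ).trace = (A * B).trace := by
    rw [hSH, Matrix.mul_assoc, trace_mul_comm, Matrix.mul_assoc, hSS, trace_mul_comm]
  rw [← htrM]
  exact hM.trace_nonneg

/-- **Thm. 2.26 / Thm. 2.20, SDP, "SDP factorization ⇒ formulation of the SAME size":** the SDP is the whole cone `𝕊^r_+`,
`X^s = B_s`, `w_𝔍(X) = C(𝔍) − Tr[A_𝔍 X] − u_𝔍`.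
[cite: BraunPokuttaRoy2016, Thm. 2.26 via proof of Thm. 2.20 (arXiv v3)] [cite: BraunPokuttaZink2015, Thm. 3.5] -/
def SDPFormulation.ofSDPFactorization (P : MaxProblem σ φ) {r : ℕ}
    (A : {f : φ // P.Sound f} → Matrix (Fin r) (Fin r) ℝ) (B : σ → Matrix (Fin r) (Fin r) ℝ)
    (u : {f : φ // P.Sound f} → ℝ) (hA : ∀ f, (A f).PosSemidef) (hB : ∀ s, (B s).PosSemidef) (hu : ∀ f, 0 ≤ u f)
    (hM : ∀ f s, P.slackMatrix f s = (A f * B s).trace + u f) : SDPFormulation P r := by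
  classical
  exact
  { k := 0
    A := 0
    b := 0
    X := B
    posSemidef_X := hB
    A_X := fun s => Subsingleton.elim _ _
    w := fun f => if h : P.Sound f then -trLin (A ⟨f, h⟩) else 0
    c := fun f => if h : P.Sound f then P.C f - u ⟨f, h⟩ else 0
    exact := fun f hf s => by
      have h := hM ⟨f, hf⟩ s
      simp only [MaxProblem.slackMatrix_apply] at h
      simp only [dif_pos hf, LinearMap.neg_apply, trLin_apply]
      linarith
    achieves := fun f hf Y hY _ => by
      simp only [dif_pos hf, LinearMap.neg_apply, trLin_apply]
      have := trace_mul_nonneg (hA ⟨f, hf⟩) hY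
      linarith [hu ⟨f, hf⟩] }

/-- **Thm. 2.26, SDP clause, exactly** (`fc_SDP(𝒫, C, S) = rk_SDP M_{𝒫,C,S}`).
[cite: BraunPokuttaRoy2016, Thm. 2.26 (arXiv v3)] [cite: BraunPokuttaZink2015, Thm. 3.5] -/
theorem SDPFormulation.nonempty_iff_hasSDPFactorization (P : MaxProblem σ φ) :
    Nonempty (SDPFormulation P d) ↔ HasSDPFactorization P.slackMatrix d := by
  constructor
  · rintro ⟨E⟩; exact E.hasSDPFactorization_slackMatrix
  · rintro ⟨A, B, u, hA, hB, hu, hM⟩; exact ⟨SDPFormulation.ofSDPFactorization P A B u hA hB hu hM⟩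

/-! ### Thm. 4.4, LP clause, exactly: `fc(𝒫,C,S) = rk_LP M` for fractional problems -/

/-- **Thm. 4.4, LP, "formulation ⇒ LP factorization of the SAME size"** (Farkas twice, common column factor `b − A x^s`,
row-dependent constants `γ ≥ 0`). [cite: BraunPokuttaRoy2016, Thm. 4.4 via Thm. 2.20 (arXiv v3)] -/
theorem FracLPFormulation.hasLPFactorization_slackMatrix {P : FracMaxProblem σ φ} (E : FracLPFormulation P R) :
    HasLPFactorization P.slackMatrix R := by
  classical
  rcases isEmpty_or_nonempty σ with hσ | ⟨⟨s₀⟩⟩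
  · exact ⟨fun _ _ => 0, fun _ s => isEmptyElim s, fun _ => 0, fun _ _ => le_rfl, fun _ s => isEmptyElim s,
      fun _ => le_rfl, fun _ s => isEmptyElim s⟩
  have hP : ∃ y : Fin E.D → ℝ, E.A *ᵥ y ≤ E.b := ⟨E.x s₀, fun i => E.mem s₀ i⟩
  have hfd : ∀ f : {f : φ // P.Sound f}, ∃ u : Fin R → ℝ, 0 ≤ u ∧ u ᵥ* E.A = -E.wd f.1 ∧
      u ⬝ᵥ E.b ≤ E.cd f.1 := fun f =>
    LPDuality.affine_farkas E.A E.b (-E.wd f.1) hP fun y hy => by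
      have := E.nonneg f.1 f.2 y (fun i => hy i)
      rw [neg_dotProduct]; linarith
  have hfn : ∀ f : {f : φ // P.Sound f}, ∃ u : Fin R → ℝ, 0 ≤ u ∧ u ᵥ* E.A = E.wn f.1 - P.C f.1 • E.wd f.1 ∧
      u ⬝ᵥ E.b ≤ P.C f.1 * E.cd f.1 - E.cn f.1 := fun f =>
    LPDuality.affine_farkas E.A E.b (E.wn f.1 - P.C f.1 • E.wd f.1) hP fun y hy => by
      have := E.achieves f.1 f.2 y (fun i => hy i)
      rw [sub_dotProduct, smul_dotProduct, smul_eq_mul]; linarith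
  choose ud hud hudA hudb using hfd
  choose un hun hunA hunb using hfn
  refine ⟨fun p => match p with
      | (false, f) => ud f
      | (true, f) => un f,
    fun i s => E.b i - (E.A *ᵥ E.x s) i,
    fun p => match p with
      | (false, f) => E.cd f.1 - ud f ⬝ᵥ E.b
      | (true, f) => P.C f.1 * E.cd f.1 - E.cn f.1 - un f ⬝ᵥ E.b,
    fun p l => ?_, fun i s => by linarith [E.mem s i], fun p => ?_, fun p s => ?_⟩
  · rcases p with ⟨_ | _, f⟩
    · exact hud f l
    · exact hun f l
  · rcases p with ⟨_ | _, f⟩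
    · show 0 ≤ E.cd f.1 - ud f ⬝ᵥ E.b; linarith [hudb f]
    · show 0 ≤ P.C f.1 * E.cd f.1 - E.cn f.1 - un f ⬝ᵥ E.b; linarith [hunb f]
  · have hsumd : ∀ u : Fin R → ℝ, ∑ i : Fin R, u i * (E.b i - (E.A *ᵥ E.x s) i) = u ⬝ᵥ E.b - u ⬝ᵥ (E.A *ᵥ E.x s) :=
      fun u => by simp only [dotProduct, mul_sub, sum_sub_distrib]
    rcases p with ⟨_ | _, f⟩
    · show P.vald f.1 s = ∑ i, ud f i * (E.b i - (E.A *ᵥ E.x s) i) + (E.cd f.1 - ud f ⬝ᵥ E.b)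
      have hws : E.wd f.1 ⬝ᵥ E.x s = -(ud f ⬝ᵥ (E.A *ᵥ E.x s)) := by
        rw [Matrix.dotProduct_mulVec, hudA f, neg_dotProduct, neg_neg]
      have hex := E.exactd f.1 f.2 s
      rw [hsumd]
      linarith
    · show P.C f.1 * P.vald f.1 s - P.valn f.1 s =
        ∑ i, un f i * (E.b i - (E.A *ᵥ E.x s) i) + (P.C f.1 * E.cd f.1 - E.cn f.1 - un f ⬝ᵥ E.b)
      have hws : (E.wn f.1 - P.C f.1 • E.wd f.1) ⬝ᵥ E.x s = un f ⬝ᵥ (E.A *ᵥ E.x s) := by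
        rw [← hunA f, Matrix.dotProduct_mulVec]
      rw [sub_dotProduct, smul_dotProduct, smul_eq_mul] at hws
      have hexn := E.exactn f.1 f.2 s
      have hexd := E.exactd f.1 f.2 s
      rw [hsumd]
      linear_combination -hws + hexn - (P.C f.1) * hexd

/-- **Thm. 4.4, LP, "LP factorization ⇒ formulation of the SAME size":** LP `x ≥ 0`, `w^d_𝔍(x) = U_{(d,𝔍)}·x + u_{(d,𝔍)}`,
`w^n_𝔍(x) = C(𝔍) w^d_𝔍(x) − U_{(n,𝔍)}·x − u_{(n,𝔍)}`. [cite: BraunPokuttaRoy2016, Thm. 4.4 via proof of Thm. 2.20 (arXiv v3)] -/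
def FracLPFormulation.ofLPFactorization (P : FracMaxProblem σ φ) {r : ℕ}
    (U : Bool × {f : φ // P.Sound f} → Fin r → ℝ) (V : Fin r → σ → ℝ) (u : Bool × {f : φ // P.Sound f} → ℝ)
    (hU : ∀ p l, 0 ≤ U p l) (hV : ∀ l s, 0 ≤ V l s) (hu : ∀ p, 0 ≤ u p)
    (hM : ∀ p s, P.slackMatrix p s = ∑ l, U p l * V l s + u p) : FracLPFormulation P r := by
  classical
  exact
  { D := r
    A := -1
    b := 0
    x := fun s l => V l s
    mem := fun s i => by simp [Matrix.neg_mulVec, hV i s]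
    wd := fun f => if h : P.Sound f then U (false, ⟨f, h⟩) else 0
    cd := fun f => if h : P.Sound f then u (false, ⟨f, h⟩) else 0
    wn := fun f => if h : P.Sound f then P.C f • U (false, ⟨f, h⟩) - U (true, ⟨f, h⟩) else 0
    cn := fun f => if h : P.Sound f then P.C f * u (false, ⟨f, h⟩) - u (true, ⟨f, h⟩) else 0
    exactd := fun f hf s => by
      have h := hM (false, ⟨f, hf⟩) s
      simp only [FracMaxProblem.slackMatrix_false] at h
      simp only [dif_pos hf, dotProduct]
      rw [h]
    exactn := fun f hf s => by
      have hd := hM (false, ⟨f, hf⟩) s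
      have hn := hM (true, ⟨f, hf⟩) s
      simp only [FracMaxProblem.slackMatrix_false, FracMaxProblem.slackMatrix_true] at hd hn
      simp only [dif_pos hf, dotProduct, Pi.sub_apply, Pi.smul_apply, smul_eq_mul]
      have : ∑ x, (P.C f * U (false, ⟨f, hf⟩) x - U (true, ⟨f, hf⟩) x) * V x s =
          P.C f * ∑ x, U (false, ⟨f, hf⟩) x * V x s - ∑ x, U (true, ⟨f, hf⟩) x * V x s := by
        rw [mul_sum, ← sum_sub_distrib]
        exact sum_congr rfl fun x _ => by ring
      rw [this]
      linear_combination (-(P.C f)) * hd + hn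
    nonneg := fun f hf y hy => by
      have hy' : ∀ l, 0 ≤ y l := fun l => by
        have := hy l; simpa [Matrix.neg_mulVec] using this
      simp only [dif_pos hf, dotProduct]
      have : 0 ≤ ∑ l, U (false, ⟨f, hf⟩) l * y l := sum_nonneg fun l _ => mul_nonneg (hU _ _) (hy' l)
      linarith [hu (false, ⟨f, hf⟩)]
    achieves := fun f hf y hy => by
      have hy' : ∀ l, 0 ≤ y l := fun l => by
        have := hy l; simpa [Matrix.neg_mulVec] using this
      simp only [dif_pos hf, sub_dotProduct, smul_dotProduct, smul_eq_mul]
      have : 0 ≤ U (true, ⟨f, hf⟩) ⬝ᵥ y := sum_nonneg fun l _ => mul_nonneg (hU _ _) (hy' l)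
      nlinarith [hu (true, ⟨f, hf⟩)] }

/-- **Thm. 4.4, LP clause, exactly** (`fc(𝒫, C, S) = rk_LP M_{𝒫,C,S}` for fractional problems).
[cite: BraunPokuttaRoy2016, Thm. 4.4 (arXiv v3)] -/
theorem FracLPFormulation.nonempty_iff_hasLPFactorization (P : FracMaxProblem σ φ) :
    Nonempty (FracLPFormulation P R) ↔ HasLPFactorization P.slackMatrix R := by
  constructor
  · rintro ⟨E⟩; exact E.hasLPFactorization_slackMatrix
  · rintro ⟨U, V, u, hU, hV, hu, hM⟩; exact ⟨FracLPFormulation.ofLPFactorization P U V u hU hV hu hM⟩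

/-! ### Remark 3.6 (BPZ15): rows with a zero entry force `u = 0`, so `rk_LP = rk_+` there -/

/-- **BPZ15 Remark 3.6**: "for the slack matrix of a polytope, every row contains a `0` entry, and hence the `μ𝟙` term in
any LP factorization must be `0`.  Therefore the nonnegative rank and LP rank coincide for polytopes" — in general: if
every row of `M` has a zero entry, an LP factorization of size `r` is a nonnegative factorization of size `r`.
[cite: BraunPokuttaZink2015, Rem. 3.6] -/
theorem HasLPFactorization.hasNonnegFactorization_of_rowZero {ι κ : Type*} {M : ι → κ → ℝ} {r : ℕ}
    (h : HasLPFactorization M r) (h0 : ∀ i, ∃ j, M i j = 0) : HasNonnegFactorization M r := by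
  obtain ⟨U, V, u, hU, hV, hu, hM⟩ := h
  have hu0 : ∀ i, u i = 0 := fun i => by
    obtain ⟨j, hj⟩ := h0 i
    have hs : 0 ≤ ∑ l, U i l * V l j := sum_nonneg fun l _ => mul_nonneg (hU _ _) (hV _ _)
    have := hM i j
    rw [hj] at this
    linarith [hu i]
  exact ⟨U, V, hU, hV, fun i j => by rw [hM i j, hu0 i, add_zero]⟩

/-- "Similar remarks apply to SDP factorizations": a zero in every row forces `u = 0` in an SDP factorization too
(`Tr[A_i B_j] ≥ 0` for psd `A_i, B_j`). [cite: BraunPokuttaZink2015, Rem. 3.6] -/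
theorem HasSDPFactorization.hasPsdFactorization_of_rowZero {ι κ : Type*} {M : ι → κ → ℝ} {r : ℕ}
    (h : HasSDPFactorization M r) (h0 : ∀ i, ∃ j, M i j = 0) : HasPsdFactorization M r := by
  obtain ⟨A, B, u, hA, hB, hu, hM⟩ := h
  have hu0 : ∀ i, u i = 0 := fun i => by
    obtain ⟨j, hj⟩ := h0 i
    have hs : 0 ≤ (A i * B j).trace := trace_mul_nonneg (hA i) (hB j)
    have := hM i j
    rw [hj] at this
    linarith [hu i]
  exact ⟨A, B, hA, hB, fun i j => by rw [hM i j, hu0 i, add_zero]⟩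

/-- For EXACT problems whose completeness guarantee is attained on every sound instance (`C(f) = val_f(s_f)` for some
`s_f`, e.g. `C = S = max val_f` over a finite nonempty solution set) every row of the slack matrix has a zero, so
`fc(𝒫, C, S) = rk_+ M_{𝒫,C,S}` on the nose: an LP formulation of size `R` exists iff the slack matrix has a nonnegative
factorization of size `R`. [cite: BraunPokuttaZink2015, Rem. 3.6 with Thm. 3.5] -/
theorem LPFormulation.nonempty_iff_hasNonnegFactorization_of_attained (P : MaxProblem σ φ)
    (hatt : ∀ f, P.Sound f → ∃ s, P.val f s = P.C f) :
    Nonempty (LPFormulation P R) ↔ HasNonnegFactorization P.slackMatrix R := by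
  have h0 : ∀ f : {f : φ // P.Sound f}, ∃ s, P.slackMatrix f s = 0 := fun f => by
    obtain ⟨s, hs⟩ := hatt f.1 f.2
    exact ⟨s, by rw [MaxProblem.slackMatrix_apply, hs, sub_self]⟩
  rw [LPFormulation.nonempty_iff_hasLPFactorization]
  exact ⟨fun h => h.hasNonnegFactorization_of_rowZero h0, fun h => h.hasLPFactorization⟩

/-- The SDP analogue: `fc_SDP(𝒫, C, S) = rk_psd M_{𝒫,C,S}` exactly when `C` is attained on every sound instance.
[cite: BraunPokuttaZink2015, Rem. 3.6 with Thm. 3.5] -/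
theorem SDPFormulation.nonempty_iff_hasPsdFactorization_of_attained (P : MaxProblem σ φ)
    (hatt : ∀ f, P.Sound f → ∃ s, P.val f s = P.C f) :
    Nonempty (SDPFormulation P d) ↔ HasPsdFactorization P.slackMatrix d := by
  have h0 : ∀ f : {f : φ // P.Sound f}, ∃ s, P.slackMatrix f s = 0 := fun f => by
    obtain ⟨s, hs⟩ := hatt f.1 f.2
    exact ⟨s, by rw [MaxProblem.slackMatrix_apply, hs, sub_self]⟩
  rw [SDPFormulation.nonempty_iff_hasSDPFactorization]
  exact ⟨fun h => h.hasPsdFactorization_of_rowZero h0, fun h => h.hasSDPFactorization⟩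

end Literature.Combinatorics.Optimization

end
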